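import Mathlib
import HarnessLib
import Summits.Ventures.LatticeQCDFlow.Scaling.GeneralLayerESSFloorSharp

/-!
# LayerFamilyExtension — using the general-layer laws with a FINITE layer family: extend
# `P : Fin n → kernel` by perfect relaxation beyond the protocol and discharge the `∀ k : ℕ`
# hypotheses; the ESS floor of `Scaling/GeneralLayerESSFloorSharp` restated for `Fin n`-indexed layers

HONEST FRAMING: exact (Metropolis-corrected) sampling algorithms for lattice gauge theory;
figures of merit are autocorrelation/cost numbers at stated couplings and volumes; no
continuum-physics claim.

Venture `LatticeQCDFlow` (cell pub-lqcd), topic `Scaling`; FANOUT row 19 (`su2-snf`, GEN-6).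
OUR WORK, nothing cited as a fact.  The general-layer laws of rows 8/19 (`GeneralLayerLagLawUniform`,
`GeneralLayerESSCeiling`, `GeneralLayerESSFloor(Sharp)`, `WorkExponentialMoments`, …) quantify their
hypotheses over EVERY `k : ℕ` (layer families indexed by `ℕ`), while a protocol only uses the layers
`k < n`.  This file provides the canonical extension and the bookkeeping:

* `extendPerfect S₀ D c P k` — `P k` for `k < n`, the perfect-relaxation layer onto
  `π_{c_{k+1}}` for `k ≥ n`; `extendPerfect_of_lt` (so `fun k : Fin n => extendPerfect … k = P`,
  `extendPerfect_fin`);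
* the four hypothesis transfers `extendPerfect_pos`, `extendPerfect_rowsum`,
  `extendPerfect_stationary`, `extendPerfect_chiSqContracts` (perfect relaxation is positive,
  stochastic, leaves its target's Boltzmann weight invariant and contracts `χ²` with `0 ≤ ρ`);
* **`exp_le_ess_path_uniform_fin`** — the `2τ̄`-form ESS floor for a `Fin n`-indexed family of
  positive stochastic layers leaving `e^{−S_{(k+1)/n}}` invariant and `χ²`-contracting with `ρ`:
  `exp(−((1+θ₂)/(1−θ₂))σ̄²/n) ≤ ÊSS`, `θ₂ = ρe^{3ΔD/n}` — hypotheses only for `k < n`.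

NOT CLAIMED: anything new mathematically; this is interface.
-/

namespace Summit.Ventures.LatticeQCDFlow.Scaling

open Finset
open Literature.Probability.MarkovChains (IsRowStochastic IsStationary stepLaw)
open Summit.Ventures.LatticeQCDFlow.Exactness
open Summit.Ventures.LatticeQCDFlow.Theory2

variable {X : Type*} [Fintype X] [Nonempty X]

/-- Extend a `Fin n`-indexed layer family by PERFECT RELAXATION onto `π_{c_{k+1}}` for `k ≥ n`. -/
noncomputable def extendPerfect {n : ℕ} (S₀ D : X → ℝ) (c : ℕ → ℝ) (P : Fin n → X → X → ℝ)
    (k : ℕ) : X → X → ℝ :=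
  if h : k < n then P ⟨k, h⟩ else fun _ y => gibbsLaw (linAction S₀ D (c (k + 1))) y

omit [Nonempty X] in
/-- Inside the protocol the extension is the given layer. -/
theorem extendPerfect_of_lt {n : ℕ} (S₀ D : X → ℝ) (c : ℕ → ℝ) (P : Fin n → X → X → ℝ)
    {k : ℕ} (h : k < n) : extendPerfect S₀ D c P k = P ⟨k, h⟩ := by
  unfold extendPerfect; rw [dif_pos h]

omit [Nonempty X] in
/-- Beyond the protocol the extension is perfect relaxation. -/
theorem extendPerfect_of_le {n : ℕ} (S₀ D : X → ℝ) (c : ℕ → ℝ) (P : Fin n → X → X → ℝ)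
    {k : ℕ} (h : n ≤ k) :
    extendPerfect S₀ D c P k = fun _ y => gibbsLaw (linAction S₀ D (c (k + 1))) y := by
  unfold extendPerfect; rw [dif_neg (not_lt.mpr h)]

omit [Nonempty X] in
/-- Restricted to `Fin n` the extension IS the given family. -/
theorem extendPerfect_fin {n : ℕ} (S₀ D : X → ℝ) (c : ℕ → ℝ) (P : Fin n → X → X → ℝ) :
    (fun k : Fin n => extendPerfect S₀ D c P k) = P := by
  funext k; rw [extendPerfect_of_lt S₀ D c P k.isLt]

/-- Positivity transfers. -/
theorem extendPerfect_pos {n : ℕ} (S₀ D : X → ℝ) (c : ℕ → ℝ) {P : Fin n → X → X → ℝ}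
    (hP : ∀ k x y, 0 < P k x y) (k : ℕ) (x y : X) : 0 < extendPerfect S₀ D c P k x y := by
  by_cases h : k < n
  · rw [extendPerfect_of_lt S₀ D c P h]; exact hP _ x y
  · rw [extendPerfect_of_le S₀ D c P (not_lt.mp h)]; exact gibbsLaw_pos _ y

/-- Unit row sums transfer. -/
theorem extendPerfect_rowsum {n : ℕ} (S₀ D : X → ℝ) (c : ℕ → ℝ) {P : Fin n → X → X → ℝ}
    (hP : ∀ k x, ∑ y, P k x y = 1) (k : ℕ) (x : X) : ∑ y, extendPerfect S₀ D c P k x y = 1 := by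
  by_cases h : k < n
  · rw [extendPerfect_of_lt S₀ D c P h]; exact hP _ x
  · rw [extendPerfect_of_le S₀ D c P (not_lt.mp h)]; exact sum_gibbsLaw _

/-- Invariance of the Boltzmann weight transfers (perfect relaxation leaves its target invariant). -/
theorem extendPerfect_stationary {n : ℕ} (S₀ D : X → ℝ) (c : ℕ → ℝ) {P : Fin n → X → X → ℝ}
    (hst : ∀ k : Fin n, IsStationary (fun x => Real.exp (-(linAction S₀ D (c (k + 1)) x))) (P k))
    (k : ℕ) : IsStationary (fun x => Real.exp (-(linAction S₀ D (c (k + 1)) x)))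
      (extendPerfect S₀ D c P k) := by
  by_cases h : k < n
  · rw [extendPerfect_of_lt S₀ D c P h]; exact hst ⟨k, h⟩
  · rw [extendPerfect_of_le S₀ D c P (not_lt.mp h)]
    intro y
    simp only
    rw [← sum_mul]
    have hZ := partitionFn_pos (linAction S₀ D (c (k + 1)))
    unfold gibbsLaw
    rw [show ∑ x, Real.exp (-(linAction S₀ D (c (k + 1)) x)) = partitionFn (linAction S₀ D (c (k + 1)))
      from rfl]
    field_simp

/-- `χ²`-contraction transfers (`ρ ≥ 0`; perfect relaxation contracts with `0`). -/
theorem extendPerfect_chiSqContracts {n : ℕ} (S₀ D : X → ℝ) (c : ℕ → ℝ) {P : Fin n → X → X → ℝ}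
    {ρ : ℝ} (hρ : 0 ≤ ρ)
    (hK : ∀ k : Fin n, ChiSqContracts (P k) (gibbsLaw (linAction S₀ D (c (k + 1)))) ρ) (k : ℕ) :
    ChiSqContracts (extendPerfect S₀ D c P k) (gibbsLaw (linAction S₀ D (c (k + 1)))) ρ := by
  by_cases h : k < n
  · rw [extendPerfect_of_lt S₀ D c P h]; exact hK ⟨k, h⟩
  · rw [extendPerfect_of_le S₀ D c P (not_lt.mp h)]
    exact (chiSqContracts_perfect _).mono (fun x => (gibbsLaw_pos _ x).le) le_rfl hρ

/-- **The `2τ̄`-form ESS floor for a `Fin n`-indexed layer family** (hypotheses only for `k < n`). -/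
theorem exp_le_ess_path_uniform_fin (S₀ D : X → ℝ) {n : ℕ} (hn : n ≠ 0)
    (P : Fin n → X → X → ℝ) {ΔD ρ σbar : ℝ} (hD : ∀ x y, |D x - D y| ≤ ΔD)
    (hPpos : ∀ k x y, 0 < P k x y)
    (hst : ∀ k : Fin n, IsStationary
      (fun x => Real.exp (-(linAction S₀ D ((((k : ℕ) + 1 : ℕ) : ℝ) / n) x))) (P k))
    (hProw : ∀ k x, ∑ y, P k x y = 1)
    (hK : ∀ k : Fin n, ChiSqContracts (P k) (gibbsLaw (linAction S₀ D ((((k : ℕ) + 1 : ℕ) : ℝ) / n))) ρ)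
    (hρ : 0 ≤ ρ) (hσ0 : 0 ≤ σbar) (hσ : ∀ c, varD S₀ D c ≤ σbar ^ 2)
    (hθ1 : ρ * Real.exp (3 * ΔD / n) < 1) :
    Real.exp (-((1 + ρ * Real.exp (3 * ΔD / n)) / (1 - ρ * Real.exp (3 * ΔD / n))
        * (σbar ^ 2 / n)))
      ≤ essFrac (revPathLaw (fun k : Fin (n + 1) => linAction S₀ D ((k : ℝ) / n)) P)
          (pathLaw (gibbsLaw (linAction S₀ D (((0 : Fin (n + 1)) : ℝ) / n))) P) := by
  set c : ℕ → ℝ := fun k => (k : ℝ) / n with hc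
  have hst0 : ∀ k : Fin n, IsStationary (fun x => Real.exp (-(linAction S₀ D (c (k + 1)) x))) (P k) :=
    fun k => by simpa only [hc] using hst k
  have hK0 : ∀ k : Fin n, ChiSqContracts (P k) (gibbsLaw (linAction S₀ D (c (k + 1)))) ρ :=
    fun k => by simpa only [hc] using hK k
  have hst' := extendPerfect_stationary S₀ D c hst0
  have hK' := extendPerfect_chiSqContracts S₀ D c hρ hK0
  have hfin : (fun k : Fin n => extendPerfect S₀ D c P k) = P := extendPerfect_fin S₀ D c P
  have h := exp_le_ess_path_uniform_sharp S₀ D (extendPerfect S₀ D c P) hn hD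
    (extendPerfect_pos S₀ D c hPpos) (fun k => by simpa only [hc] using hst' k)
    (extendPerfect_rowsum S₀ D c hProw) (fun k => by simpa only [hc] using hK' k)
    hρ hσ0 hσ hθ1
  rwa [hfin] at h

end Summit.Ventures.LatticeQCDFlow.Scaling
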